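import Mathlib.MeasureTheory.Measure.Prod
import Mathlib.MeasureTheory.Function.L1Space.Integrable
import Mathlib.MeasureTheory.Function.SpecialFunctions.Basic
import Mathlib.Analysis.SpecialFunctions.Pow.Real
import Mathlib.Analysis.SpecificLimits.Basic
import HarnessLib

/-!
# The smearing inequality and the layer-cake lemma (abstract measure theory for Weil's adelic integrability)

Track B ∕ hLiu418 = stmt-HodgeConjecture-24832, line `K2_Liu_CurveThetaSigs`, unit U5 «DOUBLING ZETA», organ (IV-d) of
socket #16b `sig_K2LiuAdelicNormIntegrable` (`Cruxes/HLiu418/Lines/K2_Liu_CurveThetaSigs_U5_DoublingZeta.lean`, ED. 5):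
«for every Haar measure `ν` on `U(V)(𝔸)` and `β` large, `g ↦ ‖g‖^{-β}` is `ν`-integrable» (Weil's adelic integrability
criterion [Weil, *Basic Number Theory*, Ch. VII §3]; Borel–Jacquet §1.2; Moeglin–Waldspurger I.2.2). Seat
`hodgecm-mathlib-K2Liu-p03` (g2), plan `K2/K2Liu-p03/g2/PLAN-16b-AdelicNormIntegrable.v1.K2Liu-p03-g2.md`, FILE 1 of 6.

The route of the plan uses NO structure theory of the group: it reduces the volume growth
`ν{g ∈ G : ‖g‖ ≤ T} ≤ C·T^D` of an arbitrary CLOSED subgroup `G ≤ GL_N(𝔸_L)` to that of the two factors `GL_N(L ⊗ ℝ)`,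
`GL_N(𝔸_{L,f})` by «smearing» `G` into `X = GL_N(L ⊗ ℝ) × GL_N(𝔸_{L,f})`, and then passes from volume growth to
integrability by summing over dyadic shells. This file proves the two ABSTRACT steps (Mathlib only):

* §1 `mul_measure_le_of_smearing` — **the smearing inequality**: `G` with a measure `μ`, `X` with a measure `λ`, a
  measurable relation `S ⊆ G × X` («`g⁻¹ • y ∈ Ω`»), a measurable `E ⊆ G`; if every section `{y : (g, y) ∈ S}`,
  `g ∈ E`, has `λ`-measure `≥ κ`, every fibre `{g ∈ E : (g, y) ∈ S}` has `μ`-measure `≤ m`, and `S ∩ (E × X)` projects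
  into `D ⊆ X`, then **`κ · μ(E) ≤ m · λ(D)`** (Tonelli: both sides bound `(μ ⊗ λ)(S ∩ (E × X))`).
* §2 `integrable_rpow_neg_of_measure_le` — **layer cake**: for a measurable `f ≥ c > 0` with polynomial volume growth
  `λ{f ≤ T} ≤ C·T^D` (`T ≥ 1`, `D : ℕ`), `f^{-β}` is `λ`-integrable for every real `β > D` (dyadic shells
  `c·2^k ≤ f < c·2^{k+1}` and a geometric series).

No definition, no instance, no named fact; axioms ⊆ {propext, Classical.choice, Quot.sound}.

## References
* A. Weil, *Basic Number Theory* (1967), Ch. VII §3 [WeilBNT1967].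
* A. Borel, H. Jacquet, *Automorphic forms and automorphic representations*, PSPM 33.1 (1979), §1.2 [BorelJacquet1979].
* C. Moeglin, J.-L. Waldspurger, *Spectral decomposition and Eisenstein series* (1995), §I.2.2 [MoeglinWaldspurger1995].

HONEST LABEL: HC_CM is proved only modulo the 7 printed citations (2 remaining named inputs: hLiu418 =
stmt-HodgeConjecture-24832, h413 = stmt-HodgeConjecture-24833) until rung 0 closes; this helper moves no counter.
-/

noncomputable section

set_option autoImplicit false

set_option linter.dupNamespace false

open MeasureTheory Set
open scoped ENNReal NNReal

namespace Summit.HodgeConjecture.HodgeConjecture.Cruxes.HLiu418.K2LiuSmearingVolumeBound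

/-! ## §1 The smearing inequality -/

/-- **The smearing inequality.** Let `μ` be a measure on `G`, `λ` a measure on `X` (both s-finite), `S ⊆ G × X` a
measurable relation and `E ⊆ G` measurable. If `κ ≤ λ{y : (g, y) ∈ S}` for every `g ∈ E`, `μ{g ∈ E : (g, y) ∈ S} ≤ m`
for every `y`, and `(g, y) ∈ S`, `g ∈ E` forces `y ∈ D`, then `κ · μ(E) ≤ m · λ(D)`: both sides bound the product
measure of `S ∩ (E × X)`, computed fibrewise in the two orders (Tonelli). In the application `G` is a closed subgroup of
`GL_N(𝔸)` with a Haar measure, `X = GL_N(𝔸_∞) × GL_N(𝔸_f)` with a Haar measure, `S = {(g, y) : g⁻¹y ∈ Ω}`, `E` a height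
ball of `G` and `D` a height ball of `X`. [folklore] [cite: WeilBNT1967, Ch. VII §3] -/
theorem mul_measure_le_of_smearing {G X : Type*} [MeasurableSpace G] [MeasurableSpace X]
    (μ : Measure G) (ν : Measure X) [SFinite μ] [SFinite ν]
    {S : Set (G × X)} (hS : MeasurableSet S) {E : Set G} (hE : MeasurableSet E)
    {κ m : ℝ≥0∞} {D : Set X}
    (hκ : ∀ g ∈ E, κ ≤ ν {y | (g, y) ∈ S})
    (hm : ∀ y, μ {g | g ∈ E ∧ (g, y) ∈ S} ≤ m)
    (hD : ∀ g ∈ E, ∀ y, (g, y) ∈ S → y ∈ D) :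
    κ * μ E ≤ m * ν D := by
  set S' : Set (G × X) := S ∩ E ×ˢ (univ : Set X) with hS'def
  have hS' : MeasurableSet S' := hS.inter (hE.prod MeasurableSet.univ)
  -- integrate first over `X`, then over `G`
  have h1 : κ * μ E ≤ (μ.prod ν) S' := by
    rw [Measure.prod_apply hS', ← lintegral_indicator_const hE κ]
    refine lintegral_mono fun g => ?_
    by_cases hg : g ∈ E
    · rw [indicator_of_mem hg]
      refine (hκ g hg).trans (measure_mono fun y hy => ?_)
      exact ⟨hy, mk_mem_prod hg (mem_univ y)⟩
    · rw [indicator_of_notMem hg]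
      exact bot_le
  -- integrate first over `G`, then over `X`
  have h2 : (μ.prod ν) S' ≤ m * ν D := by
    rw [Measure.prod_apply_symm hS']
    have hfib : ∀ y, (fun g : G => (g, y)) ⁻¹' S' = {g | g ∈ E ∧ (g, y) ∈ S} := by
      intro y
      ext g
      simp only [hS'def, mem_preimage, mem_inter_iff, mem_prod, mem_univ, and_true, mem_setOf_eq]
      exact and_comm
    calc ∫⁻ y, μ ((fun g : G => (g, y)) ⁻¹' S') ∂ν
        ≤ ∫⁻ y, D.indicator (fun _ => m) y ∂ν := by
          refine lintegral_mono fun y => ?_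
          rw [hfib y]
          by_cases hy : y ∈ D
          · rw [indicator_of_mem hy]
            exact hm y
          · rw [indicator_of_notMem hy]
            have hempty : {g | g ∈ E ∧ (g, y) ∈ S} = ∅ :=
              eq_empty_of_forall_notMem fun g hg => hy (hD g hg.1 y hg.2)
            rw [hempty, measure_empty]
      _ ≤ ∫⁻ y in D, m ∂ν := lintegral_indicator_le _ _
      _ = m * ν D := setLIntegral_const D m
  exact h1.trans h2

/-! ## §2 From polynomial volume growth to integrability of negative powers (layer cake) -/

/-- Dyadic shells: for `t ≥ c > 0` there is `k : ℕ` with `c · 2^k ≤ t ≤ c · 2^(k+1)`. [folklore] -/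
theorem exists_dyadic_shell {c t : ℝ} (hc : 0 < c) (hct : c ≤ t) :
    ∃ k : ℕ, c * 2 ^ k ≤ t ∧ t ≤ c * 2 ^ (k + 1) := by
  obtain ⟨k, hk1, hk2⟩ := exists_nat_pow_near ((one_le_div hc).2 hct) one_lt_two
  refine ⟨k, ?_, ?_⟩
  · rwa [← le_div_iff₀' hc]
  · exact ((div_le_iff₀' hc).1 hk2.le)

/-- The real bookkeeping of the dyadic bound: for `c > 0`, `C ≥ 0`, `D : ℕ`, `β : ℝ` and every `k : ℕ`,
`(c·2^k)^{-β} · (C · max(1, c·2^{k+1})^D) ≤ (c^{-β} · C · (1 + 2c)^D) · (2^{D-β})^k`. [folklore] -/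
theorem dyadic_term_le {c C β : ℝ} (hc : 0 < c) (hC : 0 ≤ C) (D k : ℕ) :
    (c * 2 ^ k) ^ (-β) * (C * (max 1 (c * 2 ^ (k + 1))) ^ D) ≤
      (c ^ (-β) * C * (1 + 2 * c) ^ D) * ((2 : ℝ) ^ ((D : ℝ) - β)) ^ k := by
  have h2k : (0 : ℝ) < 2 ^ k := pow_pos two_pos k
  have h2k1 : (1 : ℝ) ≤ 2 ^ k := one_le_pow₀ one_le_two
  -- `max 1 (c 2^{k+1}) ≤ (1 + 2c) 2^k`
  have hmax : max 1 (c * 2 ^ (k + 1)) ≤ (1 + 2 * c) * 2 ^ k := by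
    refine max_le ?_ ?_
    · calc (1 : ℝ) ≤ 1 * 2 ^ k := by rw [one_mul]; exact h2k1
        _ ≤ (1 + 2 * c) * 2 ^ k := by gcongr; linarith
    · rw [pow_succ]
      nlinarith
  have hmaxD : (max 1 (c * 2 ^ (k + 1))) ^ D ≤ ((1 + 2 * c) * 2 ^ k) ^ D :=
    pow_le_pow_left₀ (zero_le_one.trans (le_max_left _ _)) hmax D
  -- `(c 2^k)^{-β} = c^{-β} (2^k)^{-β}`
  have hsplit : (c * 2 ^ k) ^ (-β) = c ^ (-β) * ((2 : ℝ) ^ k) ^ (-β) :=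
    Real.mul_rpow hc.le h2k.le
  -- `(2^k)^{-β} · (2^k)^D = (2^{D-β})^k`
  have hpow : ((2 : ℝ) ^ k) ^ (-β) * ((2 : ℝ) ^ k) ^ D = ((2 : ℝ) ^ ((D : ℝ) - β)) ^ k := by
    rw [← Real.rpow_natCast ((2 : ℝ) ^ k) D, ← Real.rpow_add h2k, ← Real.rpow_natCast (2 : ℝ) k,
      ← Real.rpow_mul zero_le_two, ← Real.rpow_natCast ((2 : ℝ) ^ ((D : ℝ) - β)) k,
      ← Real.rpow_mul zero_le_two]
    congr 1
    ring
  have hcβ : 0 ≤ c ^ (-β) := Real.rpow_nonneg hc.le _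
  have h2β : 0 ≤ ((2 : ℝ) ^ k) ^ (-β) := Real.rpow_nonneg h2k.le _
  calc (c * 2 ^ k) ^ (-β) * (C * (max 1 (c * 2 ^ (k + 1))) ^ D)
      ≤ (c * 2 ^ k) ^ (-β) * (C * ((1 + 2 * c) * 2 ^ k) ^ D) := by
        gcongr
    _ = (c ^ (-β) * C * (1 + 2 * c) ^ D) * (((2 : ℝ) ^ k) ^ (-β) * ((2 : ℝ) ^ k) ^ D) := by
        rw [hsplit, mul_pow]; ring
    _ = (c ^ (-β) * C * (1 + 2 * c) ^ D) * ((2 : ℝ) ^ ((D : ℝ) - β)) ^ k := by rw [hpow]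

/-- **Layer cake: polynomial volume growth of the sublevel sets gives integrability of negative powers.** Let `f` be a
measurable function on `(X, λ)` with `f ≥ c > 0` everywhere, and suppose `λ{x : f x ≤ T} ≤ C · T^D` for all `T ≥ 1`
(`C ≥ 0`, `D : ℕ`). Then `x ↦ f(x)^{-β}` is `λ`-integrable for every real `β > D`: on the dyadic shell
`c·2^k ≤ f < c·2^{k+1}` the integrand is `≤ (c 2^k)^{-β}` and the shell has measure `≤ C (1+2c)^D 2^{kD}`, so the
integral is dominated by the convergent geometric series `Σ_k 2^{k(D-β)}`. This is how `vol{‖g‖ ≤ T} ≤ C T^D` yields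
`∫ ‖g‖^{-β} < ∞` [MoeglinWaldspurger1995, I.2.2]. [folklore] [cite: MoeglinWaldspurger1995, §I.2.2] -/
theorem integrable_rpow_neg_of_measure_le {X : Type*} [MeasurableSpace X] (ν : Measure X)
    {f : X → ℝ} (hf : Measurable f) {c : ℝ} (hc : 0 < c) (hcf : ∀ x, c ≤ f x)
    {C : ℝ} (hC : 0 ≤ C) {D : ℕ}
    (hvol : ∀ T : ℝ, 1 ≤ T → ν {x | f x ≤ T} ≤ ENNReal.ofReal (C * T ^ D))
    {β : ℝ} (hβ : (D : ℝ) < β) :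
    Integrable (fun x => f x ^ (-β)) ν := by
  have hfpos : ∀ x, 0 < f x := fun x => hc.trans_le (hcf x)
  -- the dyadic shells and their measures
  set A : ℕ → Set X := fun k => {x | f x ≤ c * 2 ^ (k + 1)} with hAdef
  have hA : ∀ k, MeasurableSet (A k) := fun k => hf measurableSet_Iic
  have hvolA : ∀ k, ν (A k) ≤ ENNReal.ofReal (C * (max 1 (c * 2 ^ (k + 1))) ^ D) := by
    intro k
    refine (measure_mono fun x (hx : f x ≤ _) => ?_).trans (hvol _ (le_max_left _ _))
    exact hx.trans (le_max_right _ _)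
  -- the weights
  set a : ℕ → ℝ := fun k => (c * 2 ^ k) ^ (-β) with hadef
  have ha : ∀ k, 0 ≤ a k := fun k => Real.rpow_nonneg (mul_nonneg hc.le (pow_pos two_pos k).le) _
  -- pointwise domination by the dyadic series
  have hdom : ∀ x, ENNReal.ofReal (f x ^ (-β)) ≤
      ∑' k, (A k).indicator (fun _ => ENNReal.ofReal (a k)) x := by
    intro x
    obtain ⟨k, hk1, hk2⟩ := exists_dyadic_shell hc (hcf x)
    have hxk : x ∈ A k := hk2
    calc ENNReal.ofReal (f x ^ (-β)) ≤ ENNReal.ofReal (a k) := by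
          refine ENNReal.ofReal_le_ofReal ?_
          exact Real.rpow_le_rpow_of_nonpos (mul_pos hc (pow_pos two_pos k)) hk1 (by linarith)
      _ = (A k).indicator (fun _ => ENNReal.ofReal (a k)) x := by rw [indicator_of_mem hxk]
      _ ≤ ∑' j, (A j).indicator (fun _ => ENNReal.ofReal (a j)) x := ENNReal.le_tsum k
  -- the geometric ratio
  set r : ℝ := (2 : ℝ) ^ ((D : ℝ) - β) with hrdef
  have hr0 : 0 ≤ r := Real.rpow_nonneg zero_le_two _
  have hr1 : r < 1 := Real.rpow_lt_one_of_one_lt_of_neg one_lt_two (by linarith)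
  set A₀ : ℝ := c ^ (-β) * C * (1 + 2 * c) ^ D with hA₀def
  have hA₀ : 0 ≤ A₀ := by positivity
  -- the series of shell contributions converges
  have hsum : ∑' k, ENNReal.ofReal (a k) * ν (A k) ≤ ENNReal.ofReal A₀ * (1 - ENNReal.ofReal r)⁻¹ := by
    calc ∑' k, ENNReal.ofReal (a k) * ν (A k)
        ≤ ∑' k : ℕ, ENNReal.ofReal A₀ * ENNReal.ofReal r ^ k := by
          refine ENNReal.tsum_le_tsum fun k => ?_
          calc ENNReal.ofReal (a k) * ν (A k)
              ≤ ENNReal.ofReal (a k) * ENNReal.ofReal (C * (max 1 (c * 2 ^ (k + 1))) ^ D) :=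
                mul_le_mul' le_rfl (hvolA k)
            _ = ENNReal.ofReal (a k * (C * (max 1 (c * 2 ^ (k + 1))) ^ D)) := by
                rw [← ENNReal.ofReal_mul (ha k)]
            _ ≤ ENNReal.ofReal (A₀ * r ^ k) := ENNReal.ofReal_le_ofReal (dyadic_term_le hc hC D k)
            _ = ENNReal.ofReal A₀ * ENNReal.ofReal r ^ k := by
                rw [ENNReal.ofReal_mul hA₀, ENNReal.ofReal_pow hr0]
      _ = ENNReal.ofReal A₀ * (1 - ENNReal.ofReal r)⁻¹ := by
          rw [ENNReal.tsum_mul_left, ENNReal.tsum_geometric]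
  have hfin : ENNReal.ofReal A₀ * (1 - ENNReal.ofReal r)⁻¹ < ∞ := by
    refine ENNReal.mul_lt_top ENNReal.ofReal_lt_top ?_
    refine ENNReal.inv_lt_top.2 ?_
    exact tsub_pos_iff_lt.2 ((ENNReal.ofReal_lt_one).2 hr1)
  -- assemble
  refine ⟨(hf.pow_const (-β)).aestronglyMeasurable, ?_⟩
  unfold HasFiniteIntegral
  calc ∫⁻ x, ‖f x ^ (-β)‖ₑ ∂ν = ∫⁻ x, ENNReal.ofReal (f x ^ (-β)) ∂ν := by
        refine lintegral_congr fun x => ?_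
        rw [Real.enorm_eq_ofReal (Real.rpow_nonneg (hfpos x).le _)]
    _ ≤ ∫⁻ x, ∑' k, (A k).indicator (fun _ => ENNReal.ofReal (a k)) x ∂ν := lintegral_mono hdom
    _ = ∑' k, ∫⁻ x, (A k).indicator (fun _ => ENNReal.ofReal (a k)) x ∂ν :=
        lintegral_tsum fun k => (measurable_const.indicator (hA k)).aemeasurable
    _ = ∑' k, ENNReal.ofReal (a k) * ν (A k) := by
        congr 1; funext k; rw [lintegral_indicator_const (hA k)]
    _ ≤ ENNReal.ofReal A₀ * (1 - ENNReal.ofReal r)⁻¹ := hsum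
    _ < ∞ := hfin

end Summit.HodgeConjecture.HodgeConjecture.Cruxes.HLiu418.K2LiuSmearingVolumeBound

end
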